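import Summits.QuantumAdvantage.QuantumAdvantage.Theorems.SosSandwichPseudoBoundedAAClassicalCornerQueryOSSS
import Summits.QuantumAdvantage.QuantumAdvantage.Theorems.SosSandwichPseudoBoundedAABooleanCorner
import HarnessLib

/-!
# Crux `PseudoBoundedAA` (stmt-QuantumAdvantage-15237, route SosSandwich) — the `L²`-OSSS constant on the classical corner
# is at least `8/7` (kernel certificate of the three-selector gadget)

Support file (`--supports stmt-QuantumAdvantage-15237`).  The hands' census conjecture for the classical corner `R_T` of
PB-AA is the `L²`-OSSS law `16·Var[p]² ≤ C₀·Σⱼ δ̄ⱼ·Infⱼ[p]` for probability mixtures `p = Σ_k w_k [t_k accepts]` of decision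
trees (hypothesis shape of `ClassicalCornerCalibration.classicalCorner_law_of_l2osss`); it holds with `C₀ = 1` on the
Boolean, order-one, nonadaptive and block-product corners and with `C₀ = Ī` (average sensitivity) in general
(`ClassicalCornerSensitivityOSSS`).  This file certifies in kernel that the sharp constant is NOT `1`:

* **`l2osss_const_ge_eight_sevenths`** — any `C₀` validating the law satisfies `8/7 ≤ C₀`.

Witness (found by the hands' column-generation numerics; exact family `R_m = (m+1)²/(m²+m+2)`, maximal at `m = 3`): on
`{0,1}^5` the uniform mixture of the three depth-2 trees `[x_k ? x₃ : ¬x₄]`, `k = 0,1,2`, i.e.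
`p = a·x₃ + (1−a)(1−x₄)` with `a = (x₀+x₁+x₂)/3`: `Var[p] = 1/6`, `Inf₀ = Inf₁ = Inf₂ = 1/18`, `Inf₃ = Inf₄ = 1/3`,
`δ̄₀ = δ̄₁ = δ̄₂ = 1/3`, `δ̄₃ = δ̄₄ = 1/2`, so `16·Var² = 4/9` and `Σⱼ δ̄ⱼ Infⱼ = 7/18`, ratio `8/7`.  The cube averages are
evaluated by peeling coordinates (`sum_cube_succ`, `sum_cube_zero`) and `simp`/`norm_num` on the `32` points; the gadget is
inlined in the proof (no new definitions).

Honest label: a finite certificate calibrating the constant of a conjectured inequality on a corner of an open conjecture;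
no registered stub, crux or summit is closed.  Sources: R. O'Donnell, M. Saks, O. Schramm, R. Servedio, FOCS 2005, Thm 3.2;
R. O'Donnell, *Analysis of Boolean Functions* (2014) §8.6.
-/

set_option linter.dupNamespace false

noncomputable section

namespace Summit.QuantumAdvantage.QuantumAdvantage.Theorems.SosSandwich

open Finset Function
open Literature.Computability.Complexity Literature.Computability.QuantumComplexity

namespace ClassicalCornerL2OSSSLowerBound

/-! ### Peeling cube sums -/

/-- Peel the first coordinate of a cube sum: `Σ_{x ∈ {0,1}^{n+1}} f(x) = Σ_{y ∈ {0,1}^n} (f(1∷y) + f(0∷y))`. [folklore] -/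
theorem sum_cube_succ {n : ℕ} (f : (Fin (n + 1) → Bool) → ℝ) :
    ∑ x : Fin (n + 1) → Bool, f x = ∑ y : Fin n → Bool, (f (Matrix.vecCons true y) + f (Matrix.vecCons false y)) := by
  rw [← Fintype.sum_equiv (Fin.consEquiv fun _ => Bool) (fun q => f (Fin.cons q.1 q.2)) f (fun q => rfl)]
  rw [Fintype.sum_prod_type, Fintype.sum_bool, ← Finset.sum_add_distrib]
  rfl

/-- The cube `{0,1}^0` is the single point `![]`. [folklore] -/
theorem sum_cube_zero (f : (Fin 0 → Bool) → ℝ) : ∑ x : Fin 0 → Bool, f x = f ![] := by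
  rw [Fintype.sum_unique]
  exact congrArg f (Subsingleton.elim _ _)

/-! ### The certificate (the three-selector gadget on `{0,1}^5`, everything inlined: no new definitions) -/

/-- **The `L²`-OSSS constant is at least `8/7`.** If `16·Var[p]² ≤ C₀·Σⱼ δ̄ⱼ·Infⱼ[p]` for every probability mixture of
decision trees (hypothesis shape of `ClassicalCornerCalibration.classicalCorner_law_of_l2osss`), then `8/7 ≤ C₀`: the
uniform mixture of the three depth-2 trees `[x_k ? x₃ : ¬x₄]` (`k = 0,1,2`) on `{0,1}^5` has `16·Var² = 4/9` and
`Σⱼ δ̄ⱼ Infⱼ = 7/18`. [folklore] -/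
theorem l2osss_const_ge_eight_sevenths {C₀ : ℝ}
    (hL2 : ∀ (N m : ℕ) (w : Fin m → ℝ) (t : Fin m → DecisionTree N) (p : MvPolynomial (Fin N) ℝ),
      (∀ k, 0 ≤ w k) → ∑ k, w k = 1 →
      (∀ x : Fin N → Bool, evalBool p x = ∑ k, w k * (if (t k).eval x = true then (1 : ℝ) else 0)) →
      16 * boolVariance p ^ 2 ≤ C₀ * ∑ j, (∑ k, w k *
        (((Finset.univ.filter fun x : Fin N → Bool => j ∈ (t k).queries x).card : ℝ) / (2 : ℝ) ^ N)) *
        influence j p) :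
    8 / 7 ≤ C₀ := by
  classical
  -- the gadget: selectors `0,1,2`, data `x₃`, negated data `x₄`
  let trees : Fin 3 → DecisionTree 5 := ![(DecisionTree.query 0 (.query 4 (.leaf true) (.leaf false)) (.query 3 (.leaf false) (.leaf true)) : DecisionTree 5), (DecisionTree.query 1 (.query 4 (.leaf true) (.leaf false)) (.query 3 (.leaf false) (.leaf true)) : DecisionTree 5), (DecisionTree.query 2 (.query 4 (.leaf true) (.leaf false)) (.query 3 (.leaf false) (.leaf true)) : DecisionTree 5)]
  let f : (Fin 5 → Bool) → ℝ := fun x =>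
    1 / 3 * (if (DecisionTree.query 0 (.query 4 (.leaf true) (.leaf false)) (.query 3 (.leaf false) (.leaf true)) : DecisionTree 5).eval x = true then (1 : ℝ) else 0) +
    1 / 3 * (if (DecisionTree.query 1 (.query 4 (.leaf true) (.leaf false)) (.query 3 (.leaf false) (.leaf true)) : DecisionTree 5).eval x = true then (1 : ℝ) else 0) +
    1 / 3 * (if (DecisionTree.query 2 (.query 4 (.leaf true) (.leaf false)) (.query 3 (.leaf false) (.leaf true)) : DecisionTree 5).eval x = true then (1 : ℝ) else 0)
  have hf_mix : ∀ x : Fin 5 → Bool, ∑ k : Fin 3, (1 / 3 : ℝ) * (if (trees k).eval x = true then (1 : ℝ) else 0) = f x := by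
    intro x
    simp only [Fin.sum_univ_three, trees, f]
    rfl
  -- cube sums of the gadget (peel the five coordinates, evaluate the 32 points)
  have sum_f : ∑ x : Fin 5 → Bool, f x = 16 := by
    simp only [f, sum_cube_succ, sum_cube_zero]
    simp [DecisionTree.eval]
    norm_num
  have sum_f_sq : ∑ x : Fin 5 → Bool, f x * f x = 40 / 3 := by
    simp only [f, sum_cube_succ, sum_cube_zero]
    simp [DecisionTree.eval]
    norm_num
  have sum_incr_sq : ∀ j : Fin 5,
      ∑ x : Fin 5 → Bool, (f (update x j true) - f (update x j false)) ^ 2 = ![16 / 9, 16 / 9, 16 / 9, 32 / 3, 32 / 3] j := by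
    intro j
    fin_cases j <;>
    · simp only [f, sum_cube_succ, sum_cube_zero]
      simp [DecisionTree.eval]
      norm_num
  have sum_card_queries : ∀ j : Fin 5,
      ∑ k : Fin 3, ((Finset.univ.filter fun x : Fin 5 → Bool => j ∈ (trees k).queries x).card : ℝ) =
        ![32, 32, 32, 48, 48] j := by
    intro j
    have h : ∀ t : DecisionTree 5, ((Finset.univ.filter fun x : Fin 5 → Bool => j ∈ t.queries x).card : ℝ) =
        ∑ x : Fin 5 → Bool, (if j ∈ t.queries x then (1 : ℝ) else 0) := fun t => by
      rw [Finset.natCast_card_filter]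
    simp only [Fin.sum_univ_three, trees, Matrix.cons_val_zero, Matrix.cons_val_one, Matrix.cons_val_two,
      Matrix.head_cons, Matrix.tail_cons, h]
    fin_cases j <;>
    · simp only [sum_cube_succ, sum_cube_zero]
      simp [DecisionTree.queries]
      norm_num
  -- a polynomial agreeing with `f` on the cube
  have hq : ∀ k : Fin 3, ∃ q : MvPolynomial (Fin 5) ℝ, ∀ x,
      evalBool q x = (if (trees k).eval x = true then (1 : ℝ) else 0) := fun k => by
    obtain ⟨q, -, hq⟩ := ClassicalCorner.exists_poly_of_decisionTree (trees k)
    exact ⟨q, hq⟩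
  choose q hq using hq
  set p : MvPolynomial (Fin 5) ℝ := ∑ k : Fin 3, MvPolynomial.C (1 / 3 : ℝ) * q k with hpdef
  have hp : ∀ x : Fin 5 → Bool, evalBool p x =
      ∑ k : Fin 3, (1 / 3 : ℝ) * (if (trees k).eval x = true then (1 : ℝ) else 0) := by
    intro x
    simp only [hpdef, evalBool, map_sum, map_mul, MvPolynomial.eval_C]
    refine Finset.sum_congr rfl fun k _ => ?_
    have := hq k x
    simp only [evalBool] at this
    rw [this]
  have hpf : ∀ x, evalBool p x = f x := fun x => by rw [hp x, hf_mix x]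
  -- the law applied to the gadget
  have key := hL2 5 3 (fun _ => (1 / 3 : ℝ)) trees p (fun _ => by norm_num)
    (by rw [Finset.sum_const, Finset.card_univ, Fintype.card_fin]; norm_num) hp
  -- `Var[p] = 1/6`
  have h32 : ((2 : ℝ) ^ 5) = 32 := by norm_num
  have hvar : boolVariance p = 1 / 6 := by
    have hv := BooleanCorner.sum_sq_sub_sq_sum_eq p
    simp only [hpf] at hv
    rw [sum_f_sq, sum_f, h32] at hv
    linarith
  -- `Infⱼ[p]`
  have hinf : ∀ j : Fin 5, influence j p = ![1 / 18, 1 / 18, 1 / 18, 1 / 3, 1 / 3] j := by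
    intro j
    have hi := BooleanCorner.sum_sq_update_eq_influence p j
    simp only [hpf] at hi
    rw [sum_incr_sq j, h32] at hi
    fin_cases j <;> simp at hi ⊢ <;> linarith
  -- the right-hand side `Σⱼ δ̄ⱼ Infⱼ = 7/18`
  have hrhs : ∑ j : Fin 5, (∑ k : Fin 3, (1 / 3 : ℝ) *
      (((Finset.univ.filter fun x : Fin 5 → Bool => j ∈ (trees k).queries x).card : ℝ) / (2 : ℝ) ^ 5)) *
      influence j p = 7 / 18 := by
    have hδ : ∀ j : Fin 5, ∑ k : Fin 3, (1 / 3 : ℝ) *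
        (((Finset.univ.filter fun x : Fin 5 → Bool => j ∈ (trees k).queries x).card : ℝ) / (2 : ℝ) ^ 5) =
        (![32, 32, 32, 48, 48] j) / 96 := by
      intro j
      rw [← sum_card_queries j, Finset.sum_div]
      refine Finset.sum_congr rfl fun k _ => ?_
      rw [h32]
      ring
    simp only [hδ, hinf, Fin.sum_univ_five]
    simp
    norm_num
  rw [hrhs, hvar] at key
  nlinarith [key]

end ClassicalCornerL2OSSSLowerBound

end Summit.QuantumAdvantage.QuantumAdvantage.Theorems.SosSandwich

end
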